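import Literature.Topology.FourManifolds.TwistChoice
import Literature.Topology.FourManifolds.BandCore
import HarnessLib

/-!
# Margins of the tip angles of the slide and the a priori bound of the twist

Topic `Literature/Topology/FourManifolds`; fact seat `provefact-IsStrictHandleSlide.isSurgery`
(R. C. Kirby, *The Topology of 4-Manifolds*, LNM 1374 (1989), Ch. I §4, Fig. 4.2; remaining content:
the named fact (S) `Literature.Topology.FourManifolds.FramedLink.IsStrictHandleSlide.slideModel`).
The two tips of the slid circle sit at heights `h_D ∈ [0.33, 0.45]` and `h_Dᵘ ∈ [0.55, 0.67]` of the
band end, i.e. at slice angles `ΘB h = 2π · thetaB h` (strictly decreasing, spanning less than a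
turn over `(1/10, 9/10)`: `BandCore.thetaB_window`). Hence their separation
`S = ΘB h_D - ΘB h_Dᵘ` lies in `[2η, 2π - 2η]` for the **tip margin**
`η = min (η₁, η₂, 1) > 0`, `2η₁ = ΘB 0.45 - ΘB 0.55`, `2η₂ = 2π - (ΘB 0.3 - ΘB 0.7)`
(`BandCore.tipMargin`, `BandCore.tipSep_mem`), and by `abs_twist_le` (`TwistChoice.lean`) every
twist solving the tip conditions with radii in `[1, 2]` satisfies `|c| ≤ cmax = -log tan (η/2)`
(`BandCore.abs_twist_le_cmax`) — a bound depending on the band only, available before the tips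
are fixed.

## References

* R. C. Kirby, *The Topology of 4-Manifolds*, LNM 1374, Springer (1989), Ch. I §4. [Kirby1989]
-/

open Set Real

noncomputable section

namespace Literature.Topology.FourManifolds

namespace BandCore

variable {A B : Knot} {avoid : Set (Metric.sphere (0 : EuclideanSpace ℝ (Fin 4)) 1)} (c : BandCore A B avoid)

/-- The slice angle of the band end at height `h`: `2π · thetaB h`. [folklore] -/
def ΘB (h : ℝ) : ℝ := 2 * π * c.thetaB h

/-- `ΘB_def` (auxiliary). [folklore] -/
theorem ΘB_def (h : ℝ) : c.ΘB h = 2 * π * c.thetaB h := rfl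

/-- `ΘB` is strictly decreasing on `[1/10, 9/10]`. [folklore] -/
theorem strictAntiOn_ΘB : StrictAntiOn c.ΘB (Icc 10⁻¹ (9 / 10)) := fun x hx y hy hxy ↦ by
  have := c.strictAntiOn_thetaB hx hy hxy
  simp only [ΘB]; nlinarith [pi_pos]

/-- `ΘB` spans less than a turn over `[1/10, 9/10]`. [folklore] -/
theorem ΘB_window : c.ΘB 10⁻¹ < c.ΘB (9 / 10) + 2 * π := by
  have := c.thetaB_window; simp only [ΘB]; nlinarith [pi_pos]

/-- **The tip margin** `η = min (min ((ΘB 0.45 - ΘB 0.55)/2) (π - (ΘB 0.3 - ΘB 0.7)/2)) 1`. [folklore] -/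
def tipMargin : ℝ := min (min ((c.ΘB 0.45 - c.ΘB 0.55) / 2) (π - (c.ΘB 0.3 - c.ΘB 0.7) / 2)) 1

/-- `tipMargin_pos` (auxiliary). [folklore] -/
theorem tipMargin_pos : 0 < c.tipMargin := by
  have h1 : c.ΘB 0.55 < c.ΘB 0.45 := c.strictAntiOn_ΘB (by norm_num) (by norm_num) (by norm_num)
  have h2 : c.ΘB 0.3 - c.ΘB 0.7 < 2 * π := by
    have a := c.strictAntiOn_ΘB.antitoneOn (a := 10⁻¹) (b := 0.3) (by norm_num) (by norm_num) (by norm_num)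
    have b := c.strictAntiOn_ΘB.antitoneOn (a := 0.7) (b := 9 / 10) (by norm_num) (by norm_num) (by norm_num)
    linarith [c.ΘB_window]
  unfold tipMargin
  refine lt_min (lt_min (by linarith) (by linarith)) one_pos

/-- `tipMargin_le_one` (auxiliary). [folklore] -/
theorem tipMargin_le_one : c.tipMargin ≤ 1 := min_le_right _ _

/-- `tipMargin_lt_pi_div_two` (auxiliary). [folklore] -/
theorem tipMargin_lt_pi_div_two : c.tipMargin < π / 2 := by
  have := c.tipMargin_le_one; have := pi_gt_three; linarith

/-- **The separation of the tips lies in `[2η, 2π - 2η]`.** [folklore] -/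
theorem tipSep_mem {hD hDu : ℝ} (h1 : hD ∈ Icc (0.33 : ℝ) 0.45) (h2 : hDu ∈ Icc (0.55 : ℝ) 0.67) :
    c.ΘB hD - c.ΘB hDu ∈ Icc (2 * c.tipMargin) (2 * π - 2 * c.tipMargin) := by
  have anti := c.strictAntiOn_ΘB.antitoneOn
  have hDI : hD ∈ Icc (10⁻¹ : ℝ) (9 / 10) := ⟨by linarith [h1.1], by linarith [h1.2]⟩
  have hDuI : hDu ∈ Icc (10⁻¹ : ℝ) (9 / 10) := ⟨by linarith [h2.1], by linarith [h2.2]⟩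
  have a1 : c.ΘB 0.45 ≤ c.ΘB hD := anti hDI (by norm_num) h1.2
  have a2 : c.ΘB hDu ≤ c.ΘB 0.55 := anti (by norm_num) hDuI h2.1
  have a3 : c.ΘB hD ≤ c.ΘB 0.3 := anti (by norm_num) hDI (by linarith [h1.1])
  have a4 : c.ΘB 0.7 ≤ c.ΘB hDu := anti hDuI (by norm_num) (by linarith [h2.2])
  have hm1 : c.tipMargin ≤ (c.ΘB 0.45 - c.ΘB 0.55) / 2 := (min_le_left _ _).trans (min_le_left _ _)
  have hm2 : c.tipMargin ≤ π - (c.ΘB 0.3 - c.ΘB 0.7) / 2 := (min_le_left _ _).trans (min_le_right _ _)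
  constructor <;> linarith

/-- The separation of the tips lies in `(0, 2π)`. [folklore] -/
theorem tipSep_mem_Ioo {hD hDu : ℝ} (h1 : hD ∈ Icc (0.33 : ℝ) 0.45) (h2 : hDu ∈ Icc (0.55 : ℝ) 0.67) :
    c.ΘB hD - c.ΘB hDu ∈ Ioo 0 (2 * π) := by
  have h := c.tipSep_mem h1 h2; have hη := c.tipMargin_pos
  exact ⟨by linarith [h.1], by linarith [h.2]⟩

/-- **The a priori bound of the twist.** [folklore] -/
def cmax : ℝ := -Real.log (tan (c.tipMargin / 2))

/-- Any twist solving the tip conditions (`tipSum r₁ r₂ c = S`) with radii in `[1, 2]` and the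
tips at admissible heights is bounded by `cmax`. [cite: Kirby1989, Ch. I §4] -/
theorem abs_twist_le_cmax {hD hDu r₁ r₂ tw : ℝ} (h1 : hD ∈ Icc (0.33 : ℝ) 0.45) (h2 : hDu ∈ Icc (0.55 : ℝ) 0.67)
    (hr₁ : r₁ ∈ Icc (1 : ℝ) 2) (hr₂ : r₂ ∈ Icc (1 : ℝ) 2) (htw : tipSum r₁ r₂ tw = c.ΘB hD - c.ΘB hDu) :
    |tw| ≤ c.cmax :=
  abs_twist_le hr₁ hr₂ c.tipMargin_pos c.tipMargin_lt_pi_div_two (c.tipSep_mem h1 h2) htw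

/-- `cmax_nonneg` (auxiliary). [folklore] -/
theorem cmax_nonneg : 0 ≤ c.cmax := by
  -- take any admissible configuration: e.g. `hD = 0.4`, `hDu = 0.6`, `r = 1`
  have hS := c.tipSep_mem_Ioo (hD := 0.4) (hDu := 0.6) (by norm_num) (by norm_num)
  have h := c.abs_twist_le_cmax (hD := 0.4) (hDu := 0.6) (by norm_num) (by norm_num)
    (r₁ := 1) (r₂ := 1) (by norm_num) (by norm_num) (tipSum_twistOf one_pos one_pos hS)
  exact (abs_nonneg _).trans h

end BandCore

end Literature.Topology.FourManifolds
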